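import Literature.AlgebraicGeometry.Motives.HodgeStructureOfOrientationMaximalCMSubfield
import Literature.AlgebraicGeometry.Motives.HodgeStructureOfOrientationGaloisPolarization
import HarnessLib

/-!
# Milne's Prop. 4.11 on orientations: the polarizable `n`-orientations of `F` are exactly the `n`-orientations of `F₀ = F ∩ ℚ^{cm}`, induced
# (`I(K₀) ≅ I(K)`, `f ↦ Σ f(φ|K₀) φ`; LNM 900 III (1.4) «`S^L ≅ S^{L ∩ ℚ^{cm}}`»; GGK (V.A.1) (ii)/(iv), §V.D)

[topic AlgebraicGeometry/Motives]

Layer `Literature/AlgebraicGeometry/Motives`, lane `lit-hodgefound` (Track 2 foundations library; seat `lit-hodgefound-p02`, gen 30, row g30-#11).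
THEOREMS ONLY (no definition, no named fact; D-0026 net debt `0`).  Sequel BY NAME of g30-#7 (`Motives/HodgeStructureOfOrientationMaximalCMSubfield`:
`deg_eq_of_restrictCM_eq_of_isInducedFrom`, `exists_isInducedFrom_le_maximalCMSubfield_of_isPolarizable`), g30-#4 (`…SerreCondition`:
`isPolarizable_ofOrientation_iff_forall_restrictCM`), g22-#4 (`Motives/HodgeStructureOfInducedOrientation`: `Orientation.induced`, `Orientation.restrict`,
`induced_restrict`, `isInducedFrom_induced`, `induced_injective`, `IsInducedFrom.mono`) and skel-3's `MaximalCMSubfield` / `SerreGroupMaximalCMSubfield`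
(Prop. 4.11 on CHARACTERS: `inflateCMEquiv K : X^*(S^{K₀}) ≃ X^*(S^K)`).  Here Prop. 4.11 is read on `Ξ`: for any `ℚ`-intermediate field `K₀` of `F`
with underlying subfield `F₀ = maximalCMSubfield F`, induction `Π₀ ↦ Π₀^F` is a bijection from the `n`-orientations of `K₀` onto the POLARIZABLE
`n`-orientations of `F`.

THE PRINTS.  (1) J. S. Milne, *Complex Multiplication* [MilneCM2006] Ch. I §4 (open text `paper:url-8ccc30e4daab` p0038): «PROPOSITION 4.11 Let `K` be a
number field, and let `K₀` be the composite of the CM-subfields of `K`. Then `f ↦ Σ f(φ|K₀)φ : I(K₀) → I(K)` is an isomorphism.» (2) J. S. Milne,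
K.-y. Shih, LNM 900 art. III [MilneShih1982Taniyama] §1 (1.4) p. 232: «`Λ^L ⊂ Λ^F` where `F = L ∩ ℚ^{cm}` … Since obviously `Λ^L ⊃ Λ^F`, they must be
equal: `S^L ≅ S^F`.»  (3) M. Green, P. Griffiths, M. Kerr [GreenGriffithsKerr2012] (V.A.1) (ii)/(iv) p. 155 («induced from `K`», OCMF~), (V.A.2) p. 155,
§V.D p. 163 («the SCMHS admitting a polarization are `Ξ(OCMF~)`»), Ch. V Warning p. 154.

DICTIONARY.  `F = E`, `Λ : Orientation E n`; `K₀ : IntermediateField ℚ E` with `K₀.toSubfield = maximalCMSubfield E` (Milne's `K₀`, a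
`ℚ`-intermediate-field avatar of skel-3's subfield — such a `K₀` exists, `exists_intermediateField_toSubfield_eq_maximalCMSubfield`, and no
definition is introduced); «`Σ f(φ|K₀) φ`» = `Orientation.induced (algebraMap K₀ E)` (`deg_{Π₀^F} θ = deg_{Π₀}(θ|K₀)`), «`f|K₀`» = `Orientation.restrict`.

WHAT IS PROVED (every number field `E`, every `n`).
* §0 `exists_intermediateField_toSubfield_eq_maximalCMSubfield`; `Orientation.isTotallyReal_or_isCMField_of_toSubfield_le_maximalCMSubfield` (such `K₀` is
  totally real or CM).
* §1 **polarizable ⟺ induced from `K₀`**: `Orientation.isInducedFrom_of_isPolarizable_of_maximalCMSubfield_le` (`F₀ ⊆ K₀` ⟹ every polarizable `Π` is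
  induced from `K₀`), `isPolarizable_ofOrientation_of_isInducedFrom_of_toSubfield_le` (`K₀ ⊆ F₀` ⟹ induced from `K₀` ⟹ polarizable),
  **`isPolarizable_ofOrientation_iff_isInducedFrom_of_toSubfield_eq`**.
* §2 **Prop. 4.11 on `Ξ`**: `isPolarizable_ofOrientation_induced_of_toSubfield_le` (`Π₀^F` is polarizable for every `n`-orientation `Π₀` of
  `K₀ ⊆ F₀`), `exists_induced_eq_of_isPolarizable` (every polarizable `Π` is a `Π₀^F`, `Π₀ = Π|K₀`), **`exists_induced_eq_iff_isPolarizable`**,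
  **`existsUnique_induced_eq_of_isPolarizable`** (with g22-#4's `induced_injective`: `Π₀ ↦ Π₀^F` is a BIJECTION `{n-orientations of K₀} ≃ {polarizable
  n-orientations of F}`).
* §3 The totally real case of the source field (the tree's `Orientation.two_mul_deg_eq_of_isTotallyReal`: an `n`-orientation of a totally real
  field is pure, `2·deg = n`): `Orientation.isEmpty_of_isTotallyReal_of_odd` (none in odd weight), `isPolarizable_ofOrientation_of_isTotallyReal` — so every
  `n`-orientation of `K₀` (totally real or CM) gives a polarizable `V^n_{(K₀,Π₀)}`: `isPolarizable_ofOrientation_of_toSubfield_le_maximalCMSubfield`.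

Honest scope.  `I(K₀) ≅ I(K)` itself (all infinity types, `inflateCMEquiv`) is skel-3's; here only its trace on orientations / `Ξ`.

## References
* [MilneCM2006] J. S. Milne, *Complex Multiplication* (course notes), Ch. I §4 Prop. 4.11 (p. 38), §1 Rem. 1.7 (p. 10–11).
* [MilneShih1982Taniyama] J. S. Milne, K.-y. Shih, LNM 900 (1982), art. III §1 (1.4) p. 232.
* [GreenGriffithsKerr2012] M. Green, P. Griffiths, M. Kerr, *Mumford–Tate Groups and Domains* (2012): (V.A.1) (ii)/(iv), (V.A.2) p. 155, §V.D p. 163,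
  Warning p. 154.

## Provenance
Lane `lit-hodgefound` (Hodge path, Track 2), prover seat `lit-hodgefound-p02` (generation 30), self-proposed row g30-#11 (Prop. 4.11 on `Ξ`).
-/

open NumberField NumberField.ComplexEmbedding

namespace Literature.AlgebraicGeometry.Motives

namespace HodgeStructure

open Literature.NumberTheory.ComplexMultiplication
open Literature.NumberTheory.NumberFields (maximalCMSubfield isTotallyReal_or_isCMField_maximalCMSubfield maximalRealSubfield_le_maximalCMSubfield
  isTotallyReal_or_isCMField_of_ringHom)

variable {E : Type} [Field E] [NumberField E] {n : ℤ} (Λ : Orientation E n)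

/-! ### §0 A `ℚ`-intermediate field with underlying subfield `F₀ = F ∩ ℚ^{cm}` -/

/-- There is a `ℚ`-intermediate field of `E` whose underlying subfield is the largest CM subfield `maximalCMSubfield E` (it contains `ℚ`).
[cite: MilneCM2006, Ch. I §1 Rem. 1.7 (p. 10–11)] -/
theorem exists_intermediateField_toSubfield_eq_maximalCMSubfield : ∃ K₀ : IntermediateField ℚ E, K₀.toSubfield = maximalCMSubfield E :=
  ⟨(maximalCMSubfield E).toIntermediateField fun q =>
      maximalRealSubfield_le_maximalCMSubfield ((mem_maximalRealSubfield_iff _).2 fun φ => by simp), rfl⟩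

namespace Orientation

/-- An intermediate field inside `F₀` is totally real or CM (Shimura 18.2 (iv): it embeds into the totally-real-or-CM field `F₀`).
[cite: MilneCM2006, Ch. I §1 Rem. 1.7 (p. 10–11)] -/
theorem isTotallyReal_or_isCMField_of_toSubfield_le_maximalCMSubfield {K₀ : IntermediateField ℚ E} (hK₀ : K₀.toSubfield ≤ maximalCMSubfield E) :
    IsTotallyReal K₀ ∨ IsCMField K₀ :=
  let f : K₀ →+* maximalCMSubfield E :=
    { toFun := fun z => ⟨(z : E), hK₀ z.2⟩
      map_one' := rfl
      map_mul' := fun _ _ => rfl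
      map_zero' := rfl
      map_add' := fun _ _ => rfl }
  isTotallyReal_or_isCMField_of_ringHom f isTotallyReal_or_isCMField_maximalCMSubfield

/-! ### §1 Polarizable ⟺ induced from `K₀` -/

/-- **`F₀ ⊆ K₀` ⟹ every POLARIZABLE `Π` is induced from `K₀`** (`Π` is induced from `F₀`, g30-#7, and induction is monotone).
[cite: MilneCM2006, Ch. I §4 Prop. 4.9 (b)(i), Prop. 4.11] [cite: GreenGriffithsKerr2012, (V.A.1) (ii) p. 155 and §V.D p. 163] -/
theorem isInducedFrom_of_isPolarizable_of_maximalCMSubfield_le {K₀ : IntermediateField ℚ E} (hK₀ : maximalCMSubfield E ≤ K₀.toSubfield)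
    (h : (ofOrientation Λ).IsPolarizable) : Λ.IsInducedFrom K₀ := by
  obtain ⟨K₁, hK₁, hind⟩ := Λ.exists_isInducedFrom_le_maximalCMSubfield_of_isPolarizable h
  exact hind.mono fun x hx => hK₀ (hK₁ hx)

end Orientation

/-- **`K₀ ⊆ F₀` ⟹ an orientation induced from `K₀` has `V^n_{(F,Π)}` polarizable** (its degree depends only on `θ|F₀`).
[cite: MilneCM2006, Ch. I §4 Prop. 4.9 (b), Prop. 4.11] [cite: GreenGriffithsKerr2012, (V.A.1) (iv) p. 155 and §V.D p. 163 (first bullet)] -/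
theorem isPolarizable_ofOrientation_of_isInducedFrom_of_toSubfield_le {K₀ : IntermediateField ℚ E} (hK₀ : K₀.toSubfield ≤ maximalCMSubfield E)
    (h : Λ.IsInducedFrom K₀) : (ofOrientation Λ).IsPolarizable :=
  (isPolarizable_ofOrientation_iff_forall_restrictCM Λ).2 fun _ _ hθ => Λ.deg_eq_of_restrictCM_eq_of_isInducedFrom hK₀ h hθ

/-- **`V^n_{(F,Π)}` IS POLARIZABLE IFF `Π` IS INDUCED FROM `K₀ = F ∩ ℚ^{cm}`** (for any `ℚ`-intermediate field `K₀` with underlying subfield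
`maximalCMSubfield F`). [cite: MilneShih1982Taniyama, §1 (1.4) (p. 232)] [cite: MilneCM2006, Ch. I §4 Prop. 4.11] [cite: GreenGriffithsKerr2012, §V.D p. 163 (first bullet)] -/
theorem isPolarizable_ofOrientation_iff_isInducedFrom_of_toSubfield_eq {K₀ : IntermediateField ℚ E} (hK₀ : K₀.toSubfield = maximalCMSubfield E) :
    (ofOrientation Λ).IsPolarizable ↔ Λ.IsInducedFrom K₀ :=
  ⟨Λ.isInducedFrom_of_isPolarizable_of_maximalCMSubfield_le hK₀.symm.le, isPolarizable_ofOrientation_of_isInducedFrom_of_toSubfield_le Λ hK₀.le⟩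

/-! ### §2 Prop. 4.11 on `Ξ`: `Π₀ ↦ Π₀^F` is a bijection onto the polarizable orientations -/

/-- **`V^n_{(F,Π₀^F)}` is polarizable for every `n`-orientation `Π₀` of a subfield `K₀ ⊆ F₀`** («`Σ f(φ|K₀) φ ∈ I(K)`»).
[cite: MilneCM2006, Ch. I §4 Prop. 4.11] [cite: GreenGriffithsKerr2012, (V.A.1) (ii)/(iv) p. 155 and §V.D p. 163] -/
theorem isPolarizable_ofOrientation_induced_of_toSubfield_le {K₀ : IntermediateField ℚ E} (hK₀ : K₀.toSubfield ≤ maximalCMSubfield E)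
    (Λ₀ : Orientation K₀ n) : (ofOrientation (Λ₀.induced (algebraMap K₀ E))).IsPolarizable :=
  isPolarizable_ofOrientation_of_isInducedFrom_of_toSubfield_le _ hK₀ (Orientation.isInducedFrom_induced K₀ Λ₀)

/-- **Every polarizable `Π` is `Π₀^F` for an `n`-orientation `Π₀ = Π|K₀` of `K₀ ⊇ F₀`** (surjectivity of `I(K₀) → I(K)` on orientations).
[cite: MilneCM2006, Ch. I §4 Prop. 4.11] [cite: GreenGriffithsKerr2012, (V.A.1) (ii) p. 155] -/
theorem exists_induced_eq_of_isPolarizable {K₀ : IntermediateField ℚ E} (hK₀ : maximalCMSubfield E ≤ K₀.toSubfield) (h : (ofOrientation Λ).IsPolarizable) :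
    ∃ Λ₀ : Orientation K₀ n, Λ₀.induced (algebraMap K₀ E) = Λ :=
  ⟨Λ.restrict K₀ (Λ.isInducedFrom_of_isPolarizable_of_maximalCMSubfield_le hK₀ h), Λ.induced_restrict _⟩

/-- **PROP. 4.11 ON `Ξ`: `Π` is induced from an `n`-orientation of `K₀ = F ∩ ℚ^{cm}` iff `V^n_{(F,Π)}` is polarizable.**
[cite: MilneCM2006, Ch. I §4 Prop. 4.11] [cite: MilneShih1982Taniyama, §1 (1.4) (p. 232)] [cite: GreenGriffithsKerr2012, §V.D p. 163 (first bullet)] -/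
theorem exists_induced_eq_iff_isPolarizable {K₀ : IntermediateField ℚ E} (hK₀ : K₀.toSubfield = maximalCMSubfield E) :
    (∃ Λ₀ : Orientation K₀ n, Λ₀.induced (algebraMap K₀ E) = Λ) ↔ (ofOrientation Λ).IsPolarizable := by
  refine ⟨?_, exists_induced_eq_of_isPolarizable Λ hK₀.symm.le⟩
  rintro ⟨Λ₀, rfl⟩
  exact isPolarizable_ofOrientation_induced_of_toSubfield_le hK₀.le Λ₀

/-- **… and `Π₀` is unique** (`Π₀ ↦ Π₀^F` is injective, g22-#4): `{n-orientations of K₀} ≃ {polarizable n-orientations of F}` — «`I(K₀) → I(K)` is an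
isomorphism» on orientations. [cite: MilneCM2006, Ch. I §4 Prop. 4.11] [cite: MilneShih1982Taniyama, §1 (1.4) (p. 232)] -/
theorem existsUnique_induced_eq_of_isPolarizable {K₀ : IntermediateField ℚ E} (hK₀ : maximalCMSubfield E ≤ K₀.toSubfield)
    (h : (ofOrientation Λ).IsPolarizable) : ∃! Λ₀ : Orientation K₀ n, Λ₀.induced (algebraMap K₀ E) = Λ := by
  obtain ⟨Λ₀, hΛ₀⟩ := exists_induced_eq_of_isPolarizable Λ hK₀ h
  exact ⟨Λ₀, hΛ₀, fun Λ₁ hΛ₁ => Orientation.induced_injective K₀ (hΛ₁.trans hΛ₀.symm)⟩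

/-! ### §3 The source side: orientations of a totally real or CM field are all polarizable -/

namespace Orientation

/-- **A totally real field has NO `n`-orientation of odd weight.** [cite: GreenGriffithsKerr2012, Ch. V Warning p. 154] [cite: MilneCM2006, Ch. I §4 Prop. 4.11] -/
theorem isEmpty_of_isTotallyReal_of_odd [IsTotallyReal E] (hn : Odd n) : IsEmpty (Orientation E n) := by
  refine ⟨fun Λ => ?_⟩
  obtain ⟨θ⟩ := (inferInstance : Nonempty (E →+* ℂ))
  have h := Λ.two_mul_deg_eq_of_isTotallyReal θ
  obtain ⟨k, hk⟩ := hn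
  omega

/-- An `n`-orientation of a totally real field is induced from `ℚ`. [cite: GreenGriffithsKerr2012, Ch. V Warning p. 154] -/
theorem isInducedFrom_bot_of_isTotallyReal [IsTotallyReal E] (Λ : Orientation E n) : Λ.IsInducedFrom ⊥ :=
  Λ.isInducedFrom_bot_iff.2 fun θ θ' => by
    have h1 := Λ.two_mul_deg_eq_of_isTotallyReal θ
    have h2 := Λ.two_mul_deg_eq_of_isTotallyReal θ'
    omega

end Orientation

/-- **`V^n_{(F,Π)}` is polarizable for EVERY orientation of a totally real `F`** (it is of pure type `(n/2,n/2)`).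
[cite: GreenGriffithsKerr2012, Ch. V Warning p. 154] [cite: VoisinHodgeI2002, §7.1.2] -/
theorem isPolarizable_ofOrientation_of_isTotallyReal [IsTotallyReal E] (Λ : Orientation E n) : (ofOrientation Λ).IsPolarizable :=
  isPolarizable_ofOrientation_of_isInducedFrom_bot Λ Λ.isInducedFrom_bot_of_isTotallyReal

/-- **Every `n`-orientation of a subfield `K₀ ⊆ F₀ = F ∩ ℚ^{cm}` has `V^n_{(K₀,Π₀)}` polarizable** (`K₀` is totally real or CM; GGK «`Ξ(OCMF)` are
polarizable» / the pure case). [cite: GreenGriffithsKerr2012, §V.D pp. 162–163 and Warning p. 154] [cite: MilneCM2006, Ch. I §4 Prop. 4.11] -/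
theorem isPolarizable_ofOrientation_of_toSubfield_le_maximalCMSubfield {K₀ : IntermediateField ℚ E} (hK₀ : K₀.toSubfield ≤ maximalCMSubfield E)
    (Λ₀ : Orientation K₀ n) : (ofOrientation Λ₀).IsPolarizable := by
  rcases Orientation.isTotallyReal_or_isCMField_of_toSubfield_le_maximalCMSubfield hK₀ with hR | hC
  · haveI := hR
    exact isPolarizable_ofOrientation_of_isTotallyReal Λ₀
  · haveI := hC
    exact isPolarizable_ofOrientation Λ₀

end HodgeStructure

end Literature.AlgebraicGeometry.Motives
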